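import Literature.MathematicalPhysics.QuantumFieldTheory.QCDFlavourSymmetry
import Literature.MathematicalPhysics.QuantumFieldTheory.QCDCurrentSector
import Literature.MathematicalPhysics.QuantumFieldTheory.QCDTorusTranslation
import Literature.MathematicalPhysics.QuantumFieldTheory.QCDTimeReflectionProofs
import Literature.MathematicalPhysics.QuantumLattice.GrassmannCoefficientRegularity
import Summits.QuantumFields.QCD.Theorems.QuarksNoInfraredClauseTorusHalfSpectrumStubSelectionRule
import HarnessLib

/-!
# Crux `TorusHalfSpectrum` (stmt-QuantumFields-9508), line `registered` (`Lines/birth.lean`, reshape v3) —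
# stub `stub_composite_observable`: the split composites `A · τ_v B` as gauge-invariant local observables

Stub C of the birth skeleton of the crux
`Summit.QuantumFields.QCD.Theses.QuarksNoInfraredClause.TorusHalfSpectrum` (= `CompositeStmt` unfolded):
for gauge-invariant local lattice-QCD observables `A` (quark box `R`), `B` (quark box `R'`) and a lattice
vector `v ∈ ℤ⁴` there is a quark box `R''` and an observable `N : QCDLatticeObservable N_f R''` with

* the PLACEMENT IDENTITY on every odd torus:
  `N.onTorus (2S+1) u U = A.onTorus (2S+1) u U * B.onTorus (2S+1) (u+v) U`;
* ADDITIVE FLAVOUR CHARGE: if the vector flavour torus multiplies `A.F U` by `∏_f t_f^{q_A f}` and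
  `B.F U` by `∏_f t_f^{q_B f}`, then it multiplies `N.F U` by `∏_f t_f^{(q_A+q_B) f}`.

Construction (Osterwalder–Seiler's algebra of local observables is closed under products of
TRANSLATES; this is its typed form next to `QCDObservableProduct.instMul`, which only multiplies
observables of the same box at the same place).  Take `R'' = R + R' + Σ_i |v_i|`, so that the cube of
radius `R` and the `v`-translate of the cube of radius `R'` both lie in the cube of radius `R''`.  A map
of boxed sites `σ : {−R..R}⁴ → {−R''..R''}⁴` with `σ x = x + w` induces the linear map of generator
coefficients `e_{ψ̄/ψ,(f,x,a,α)} ↦ e_{ψ̄/ψ,(f,σx,a,α)}` (`exists_embedLin`) and the algebra map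
`Φ_w = Λ(it)` of boxed quark Grassmann algebras (`exists_embedAlg`), which

* intertwines the gauge actions, `g · Φ_w(y) = Φ_w((g(· + w)) · y)` (checked on generators,
  `fermiGaugeLin_single_inl/inr`: the gauge rotation acts on colour at the site);
* commutes with the vector flavour torus (its weights depend only on flavour and on the `ψ̄/ψ`
  type, both preserved);
* is compatible with the torus placement: `Λ(P_u) ∘ Φ_w = Λ(P_{u+w})` (`toTorusIdx` bookkeeping:
  both send `(f,x,a,α)` to the torus variable at `x + w + u mod S`).

Then `N.F U := Φ_0(A.F (θ_{−0} U)) · Φ_v(B.F (θ_{−v} U))` (`θ` = `configShift`): a cylinder function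
(support `A.supp ∪ (B.supp + v)`), jointly gauge invariant (`θ_{−v}(U^g) = (θ_{−v}U)^{g(·+v)}`),
with bounded measurable Grassmann coefficients (`CoeffRegular` calculus: algebra maps, measurable
substitutions and products preserve coefficient regularity; the Berezin pairings are fixed linear
functionals); the placement identity is `map_mul` + the compatibility above +
`θ_{−v} θ_{−u} = θ_{−(u+v)}`, and the charges add by `map_mul`, the commutation above and
`∏ t^{q_A} ∏ t^{q_B} = ∏ t^{q_A+q_B}` (`t_f ≠ 0`, `SelectionRule.prod_zpow_mul_prod_zpow`).

Everything used is proved in the tree (no named fact).  Sources: K. Osterwalder, E. Seiler,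
Ann. Phys. 110 (1978) 440, §2 (the algebra of gauge-invariant local observables); I. Montvay,
G. Münster, *Quantum Fields on a Lattice* (CUP 1994), §5.1.1 (5.3), (5.6) (gauge and flavour
transformations of quark fields).
-/

noncomputable section

namespace Summit.QuantumFields.QCD.Cruxes.TorusHalfSpectrum.Birth.CompositeObservable

open scoped BigOperators
open Literature.MathematicalPhysics.QuantumFieldTheory Literature.MathematicalPhysics.QuantumLattice
open Literature.Probability.LatticeModels (box mem_box)
open Summit.QuantumFields.QCD.Cruxes.TorusHalfSpectrum.Birth.SelectionRule (prod_zpow_mul_prod_zpow)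

variable {Nf R R' R'' : ℕ}

/-! ### Boxes: the cube of radius `R` translated by `w` inside a larger cube -/

/-- A translate of the cube `{−R,…,R}⁴` by `w` lies in the cube of radius `R''` as soon as
`R + |w_i| ≤ R''` for every coordinate: the translation as a map of boxed sites. -/
theorem exists_boxShift (w : Literature.Probability.LatticeModels.Site 4) (h : ∀ i, R + (w i).natAbs ≤ R'') :
    ∃ σ : ↥(box 4 R) → ↥(box 4 R''),
      ∀ x, ((σ x : ↥(box 4 R'')) : Literature.Probability.LatticeModels.Site 4) =
        (x : Literature.Probability.LatticeModels.Site 4) + w := by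
  refine ⟨fun x => ⟨(x : Literature.Probability.LatticeModels.Site 4) + w, ?_⟩, fun x => rfl⟩
  have hx := mem_box.1 x.2
  rw [mem_box]
  intro i
  have h1 := hx i
  have h2 := h i
  simp only [Pi.add_apply]
  omega

/-! ### The embedding of boxed quark Grassmann algebras along a map of boxed sites -/

/-- The linear map of generator coefficients induced by a map `σ` of boxed sites:
`e_{ψ̄,(f,x,a,α)} ↦ e_{ψ̄,(f,σx,a,α)}`, `e_{ψ,(f,x,a,α)} ↦ e_{ψ,(f,σx,a,α)}`. -/
theorem exists_embedLin (σ : ↥(box 4 R) → ↥(box 4 R'')) :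
    ∃ L : ((BoxFermiIdx Nf R ⊕ₗ BoxFermiIdx Nf R) → ℂ) →ₗ[ℂ]
        ((BoxFermiIdx Nf R'' ⊕ₗ BoxFermiIdx Nf R'') → ℂ),
      (∀ (f : Fin Nf) (x : ↥(box 4 R)) (a : Fin 3) (α : Fin 4),
          L (Pi.single (toLex (Sum.inl (boxQuarkEquiv (f, (x, a, α))))) 1) =
            Pi.single (toLex (Sum.inl (boxQuarkEquiv (Nf := Nf) (R := R'') (f, (σ x, a, α))))) 1) ∧
      (∀ (f : Fin Nf) (x : ↥(box 4 R)) (a : Fin 3) (α : Fin 4),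
          L (Pi.single (toLex (Sum.inr (boxQuarkEquiv (f, (x, a, α))))) 1) =
            Pi.single (toLex (Sum.inr (boxQuarkEquiv (Nf := Nf) (R := R'') (f, (σ x, a, α))))) 1) := by
  refine ⟨Fintype.linearCombination ℂ fun w => Pi.single (toLex (Sum.map
      (fun i : BoxFermiIdx Nf R => boxQuarkEquiv (Nf := Nf) (R := R'')
        ((boxQuarkEquiv.symm i).1, (σ (boxQuarkEquiv.symm i).2.1, (boxQuarkEquiv.symm i).2.2)))
      (fun i : BoxFermiIdx Nf R => boxQuarkEquiv (Nf := Nf) (R := R'')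
        ((boxQuarkEquiv.symm i).1, (σ (boxQuarkEquiv.symm i).2.1, (boxQuarkEquiv.symm i).2.2)))
      (ofLex w))) (1 : ℂ), fun f x a α => ?_, fun f x a α => ?_⟩
  · simp only [Fintype.linearCombination_apply_single, one_smul, ofLex_toLex, Sum.map_inl,
      Equiv.symm_apply_apply]
  · simp only [Fintype.linearCombination_apply_single, one_smul, ofLex_toLex, Sum.map_inr,
      Equiv.symm_apply_apply]

section Embedding

variable (w : Literature.Probability.LatticeModels.Site 4) (σ : ↥(box 4 R) → ↥(box 4 R''))
  (hσ : ∀ x, ((σ x : ↥(box 4 R'')) : Literature.Probability.LatticeModels.Site 4) =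
    (x : Literature.Probability.LatticeModels.Site 4) + w)
  (L : ((BoxFermiIdx Nf R ⊕ₗ BoxFermiIdx Nf R) → ℂ) →ₗ[ℂ]
    ((BoxFermiIdx Nf R'' ⊕ₗ BoxFermiIdx Nf R'') → ℂ))
  (hLl : ∀ (f : Fin Nf) (x : ↥(box 4 R)) (a : Fin 3) (α : Fin 4),
    L (Pi.single (toLex (Sum.inl (boxQuarkEquiv (f, (x, a, α))))) 1) =
      Pi.single (toLex (Sum.inl (boxQuarkEquiv (Nf := Nf) (R := R'') (f, (σ x, a, α))))) 1)
  (hLr : ∀ (f : Fin Nf) (x : ↥(box 4 R)) (a : Fin 3) (α : Fin 4),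
    L (Pi.single (toLex (Sum.inr (boxQuarkEquiv (f, (x, a, α))))) 1) =
      Pi.single (toLex (Sum.inr (boxQuarkEquiv (Nf := Nf) (R := R'') (f, (σ x, a, α))))) 1)

include hLl hLr

/-- **The coefficient embedding commutes with the vector flavour torus** (the diagonal weights
`t_f⁻¹` on `ψ̄_f`, `t_f` on `ψ_f` depend only on the flavour and the `ψ̄/ψ` type, both preserved). -/
theorem flavourLin_comp_embed (t : Fin Nf → ℂ) :
    (LinearMap.pi fun w' => QCDLatticeObservable.flavourWeight t w' •
        (LinearMap.proj w' : (BoxFermiIdx Nf R'' ⊕ₗ BoxFermiIdx Nf R'' → ℂ) →ₗ[ℂ] ℂ)) ∘ₗ L =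
      L ∘ₗ (LinearMap.pi fun w' => QCDLatticeObservable.flavourWeight t w' •
        (LinearMap.proj w' : (BoxFermiIdx Nf R ⊕ₗ BoxFermiIdx Nf R → ℂ) →ₗ[ℂ] ℂ)) := by
  refine (Pi.basisFun ℂ _).ext fun w' => ?_
  obtain ⟨y, rfl⟩ : ∃ y, toLex y = w' := ⟨ofLex w', rfl⟩
  rcases y with i | i
  · obtain ⟨⟨f, x, a, α⟩, rfl⟩ := boxQuarkEquiv.surjective i
    rw [Pi.basisFun_apply, LinearMap.comp_apply, LinearMap.comp_apply, hLl, pi_diag_single,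
      pi_diag_single, map_smul, hLl, QCDLatticeObservable.flavourWeight_inl,
      QCDLatticeObservable.flavourWeight_inl, Equiv.symm_apply_apply, Equiv.symm_apply_apply]
  · obtain ⟨⟨f, x, a, α⟩, rfl⟩ := boxQuarkEquiv.surjective i
    rw [Pi.basisFun_apply, LinearMap.comp_apply, LinearMap.comp_apply, hLr, pi_diag_single,
      pi_diag_single, map_smul, hLr, QCDLatticeObservable.flavourWeight_inr,
      QCDLatticeObservable.flavourWeight_inr, Equiv.symm_apply_apply, Equiv.symm_apply_apply]

include hσ

/-- **The coefficient embedding intertwines the gauge substitutions**: `G_g ∘ L = L ∘ G_{g(· + w)}`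
(the gauge rotation acts on the colour index at the site, which `σ` translates by `w`). -/
theorem fermiGaugeLin_comp_embed
    (g : Literature.Probability.LatticeModels.Site 4 → Matrix.specialUnitaryGroup (Fin 3) ℂ) :
    fermiGaugeLin (Nf := Nf) (R := R'') g ∘ₗ L =
      L ∘ₗ fermiGaugeLin (Nf := Nf) (R := R) (fun z => g (z + w)) := by
  refine (Pi.basisFun ℂ _).ext fun w' => ?_
  obtain ⟨y, rfl⟩ : ∃ y, toLex y = w' := ⟨ofLex w', rfl⟩
  rcases y with i | i
  · obtain ⟨⟨f, x, a, α⟩, rfl⟩ := boxQuarkEquiv.surjective i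
    rw [Pi.basisFun_apply, LinearMap.comp_apply, LinearMap.comp_apply, hLl, fermiGaugeLin_single_inl,
      fermiGaugeLin_single_inl, map_sum]
    simp only [map_smul, hLl, hσ]
  · obtain ⟨⟨f, x, a, α⟩, rfl⟩ := boxQuarkEquiv.surjective i
    rw [Pi.basisFun_apply, LinearMap.comp_apply, LinearMap.comp_apply, hLr, fermiGaugeLin_single_inr,
      fermiGaugeLin_single_inr, map_sum]
    simp only [map_smul, hLr, hσ]

/-- **The coefficient embedding is compatible with the torus placement**: `P_u ∘ L = P_{u+w}` (both send
the coefficient of `(f,x,a,α)` to that of the torus variable `(f, x + w + u mod S, a, α)`). -/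
theorem placeLin_comp_embed (S : ℕ) [NeZero S] (u : Literature.Probability.LatticeModels.Site 4) :
    placeLin Nf R'' S u ∘ₗ L = placeLin Nf R S (u + w) := by
  refine (Pi.basisFun ℂ _).ext fun w' => ?_
  obtain ⟨y, rfl⟩ : ∃ y, toLex y = w' := ⟨ofLex w', rfl⟩
  rcases y with i | i
  · obtain ⟨⟨f, x, a, α⟩, rfl⟩ := boxQuarkEquiv.surjective i
    rw [Pi.basisFun_apply, LinearMap.comp_apply, hLl, placeLin_single, placeLin_single]
    simp only [QCDLatticeObservable.toTorusIdx, ofLex_toLex, Equiv.symm_apply_apply, hσ]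
    rw [add_assoc, add_comm w u]
  · obtain ⟨⟨f, x, a, α⟩, rfl⟩ := boxQuarkEquiv.surjective i
    rw [Pi.basisFun_apply, LinearMap.comp_apply, hLr, placeLin_single, placeLin_single]
    simp only [QCDLatticeObservable.toTorusIdx, ofLex_toLex, Equiv.symm_apply_apply, hσ]
    rw [add_assoc, add_comm w u]

end Embedding

/-- **The embedding `Φ_w` of boxed quark Grassmann algebras along the translation `x ↦ x + w` of boxed
sites** (the algebra map induced on generators by `ψ̄_{f,x,a,α} ↦ ψ̄_{f,x+w,a,α}`,
`ψ_{f,x,a,α} ↦ ψ_{f,x+w,a,α}`): it intertwines the gauge actions (`g · Φ_w y = Φ_w (g(· + w) · y)`),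
commutes with the vector flavour torus, and placing its values at `u` on a torus is placing the argument
at `u + w`. -/
theorem exists_embedAlg (w : Literature.Probability.LatticeModels.Site 4) (σ : ↥(box 4 R) → ↥(box 4 R''))
    (hσ : ∀ x, ((σ x : ↥(box 4 R'')) : Literature.Probability.LatticeModels.Site 4) =
      (x : Literature.Probability.LatticeModels.Site 4) + w) :
    ∃ Φ : BoxFermiAlg Nf R →ₐ[ℂ] BoxFermiAlg Nf R'',
      (∀ (g : Literature.Probability.LatticeModels.Site 4 → Matrix.specialUnitaryGroup (Fin 3) ℂ)
          (y : BoxFermiAlg Nf R), fermiGaugeAct g (Φ y) = Φ (fermiGaugeAct (fun z => g (z + w)) y)) ∧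
      (∀ (t : Fin Nf → ℂ) (y : BoxFermiAlg Nf R),
          QCDLatticeObservable.flavourScale t (Φ y) = Φ (QCDLatticeObservable.flavourScale t y)) ∧
      (∀ (S : ℕ) [NeZero S] (u : Literature.Probability.LatticeModels.Site 4) (y : BoxFermiAlg Nf R),
          ExteriorAlgebra.map (placeLin Nf R'' S u) (Φ y) =
            ExteriorAlgebra.map (placeLin Nf R S (u + w)) y) := by
  obtain ⟨L, hLl, hLr⟩ := exists_embedLin (Nf := Nf) σ
  refine ⟨ExteriorAlgebra.map L, fun g y => ?_, fun t y => ?_, fun S _ u y => ?_⟩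
  · simp only [fermiGaugeAct]
    rw [← AlgHom.comp_apply, ExteriorAlgebra.map_comp_map, fermiGaugeLin_comp_embed w σ hσ L hLl hLr,
      ← ExteriorAlgebra.map_comp_map, AlgHom.comp_apply]
  · rw [QCDLatticeObservable.flavourScale_eq, QCDLatticeObservable.flavourScale_eq, ← AlgHom.comp_apply,
      ExteriorAlgebra.map_comp_map, flavourLin_comp_embed σ L hLl hLr, ← ExteriorAlgebra.map_comp_map,
      AlgHom.comp_apply]
  · rw [← AlgHom.comp_apply, ExteriorAlgebra.map_comp_map, placeLin_comp_embed w σ hσ L hLl hLr]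

/-! ### The composite observable -/

/-- Translation intertwines gauge transformations: `θ_{−v}(U^g) = (θ_{−v} U)^{g(· + v)}`. -/
theorem configShift_neg_gaugeTransformZd (v : Literature.Probability.LatticeModels.Site 4)
    (g : Literature.Probability.LatticeModels.Site 4 → Matrix.specialUnitaryGroup (Fin 3) ℂ)
    (U : LGConfig 4 (Matrix.specialUnitaryGroup (Fin 3) ℂ)) :
    configShift (-v) (gaugeTransformZd g U) = gaugeTransformZd (fun z => g (z + v)) (configShift (-v) U) := by
  funext e
  simp only [configShift_apply, gaugeTransformZd, sub_neg_eq_add, add_right_comm _ _ v]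

/-- **The composite `A(· + v_A) · B(· + v_B)` as ONE gauge-invariant local observable** in a common quark
box `R''` containing the `v_A`-translate of the box of `A` and the `v_B`-translate of the box of `B`:
`N.F U = Φ_{v_A}(A.F (θ_{−v_A} U)) · Φ_{v_B}(B.F (θ_{−v_B} U))`.  It is placed on every torus as the
product of the placements of `A` at `u + v_A` and of `B` at `u + v_B`, and its flavour charge is the sum
of the charges. -/
theorem exists_composite (A : QCDLatticeObservable Nf R) (B : QCDLatticeObservable Nf R')
    (vA vB : Literature.Probability.LatticeModels.Site 4)
    (σA : ↥(box 4 R) → ↥(box 4 R''))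
    (hσA : ∀ x, ((σA x : ↥(box 4 R'')) : Literature.Probability.LatticeModels.Site 4) =
      (x : Literature.Probability.LatticeModels.Site 4) + vA)
    (σB : ↥(box 4 R') → ↥(box 4 R''))
    (hσB : ∀ x, ((σB x : ↥(box 4 R'')) : Literature.Probability.LatticeModels.Site 4) =
      (x : Literature.Probability.LatticeModels.Site 4) + vB) :
    ∃ N : QCDLatticeObservable Nf R'',
      (∀ (S : ℕ) [NeZero S] (u : Literature.Probability.LatticeModels.Site 4)
          (U : GaugeConfig 4 S (Matrix.specialUnitaryGroup (Fin 3) ℂ)),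
          N.onTorus S u U = A.onTorus S (u + vA) U * B.onTorus S (u + vB) U) ∧
      ∀ qA qB : Fin Nf → ℤ,
        (∀ t : Fin Nf → ℂ, (∀ f, t f ≠ 0) → ∀ U,
            QCDLatticeObservable.flavourScale t (A.F U) = (∏ f, t f ^ (qA f)) • A.F U) →
        (∀ t : Fin Nf → ℂ, (∀ f, t f ≠ 0) → ∀ U,
            QCDLatticeObservable.flavourScale t (B.F U) = (∏ f, t f ^ (qB f)) • B.F U) →
        ∀ t : Fin Nf → ℂ, (∀ f, t f ≠ 0) → ∀ U,
            QCDLatticeObservable.flavourScale t (N.F U) = (∏ f, t f ^ ((qA + qB) f)) • N.F U := by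
  obtain ⟨ΦA, hAg, hAt, hAp⟩ := exists_embedAlg (Nf := Nf) vA σA hσA
  obtain ⟨ΦB, hBg, hBt, hBp⟩ := exists_embedAlg (Nf := Nf) vB σB hσB
  -- coefficient regularity of the two factors and of the product
  have hAreg : GrassmannAlgebra.CoeffRegular
      (fun U : LGConfig 4 (Matrix.specialUnitaryGroup (Fin 3) ℂ) => A.F U) :=
    GrassmannAlgebra.coeffRegular_of_pairing (fun s => exists_berezin_mul_eq_coord ℂ s)
      A.measurable A.bounded
  have hBreg : GrassmannAlgebra.CoeffRegular
      (fun U : LGConfig 4 (Matrix.specialUnitaryGroup (Fin 3) ℂ) => B.F U) :=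
    GrassmannAlgebra.coeffRegular_of_pairing (fun s => exists_berezin_mul_eq_coord ℂ s)
      B.measurable B.bounded
  have hN : GrassmannAlgebra.CoeffRegular (fun U : LGConfig 4 (Matrix.specialUnitaryGroup (Fin 3) ℂ) =>
      ΦA (A.F (configShift (-vA) U)) * ΦB (B.F (configShift (-vB) U))) :=
    ((hAreg.comp (configShift (-vA)).measurable).algHom ΦA).mul
      ((hBreg.comp (configShift (-vB)).measurable).algHom ΦB)
  refine ⟨{ F := fun U => ΦA (A.F (configShift (-vA) U)) * ΦB (B.F (configShift (-vB) U))
            supp := A.supp.image (fun e => (e.1 - -vA, e.2)) ∪ B.supp.image (fun e => (e.1 - -vB, e.2))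
            isCylinder := ?_
            gaugeInvariant := ?_
            bounded := fun y => (hN.mul (GrassmannAlgebra.coeffRegular_const y)).exists_norm_apply_le
              (GrassmannAlgebra.berezin ℂ _)
            measurable := fun y => (hN.mul (GrassmannAlgebra.coeffRegular_const y)).measurable_apply
              (GrassmannAlgebra.berezin ℂ _) },
    ?_, ?_⟩
  · -- cylinder: `A` reads the links of `A.supp + vA`, `B` those of `B.supp + vB`
    intro U V hUV
    change ΦA (A.F (configShift (-vA) U)) * ΦB (B.F (configShift (-vB) U)) =
      ΦA (A.F (configShift (-vA) V)) * ΦB (B.F (configShift (-vB) V))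
    rw [A.isCylinder (fun e he => ?_ :
        ∀ e ∈ (↑A.supp : Set (Literature.MathematicalPhysics.QuantumLattice.ZdEdge 4)),
          configShift (-vA) U e = configShift (-vA) V e),
      B.isCylinder (fun e he => ?_ :
        ∀ e ∈ (↑B.supp : Set (Literature.MathematicalPhysics.QuantumLattice.ZdEdge 4)),
          configShift (-vB) U e = configShift (-vB) V e)]
    · simp only [configShift_apply]
      exact hUV _ (Finset.mem_coe.2 (Finset.mem_union_right _ (Finset.mem_image_of_mem
        (fun e : Literature.MathematicalPhysics.QuantumLattice.ZdEdge 4 => (e.1 - -vB, e.2))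
        (Finset.mem_coe.1 he))))
    · simp only [configShift_apply]
      exact hUV _ (Finset.mem_coe.2 (Finset.mem_union_left _ (Finset.mem_image_of_mem
        (fun e : Literature.MathematicalPhysics.QuantumLattice.ZdEdge 4 => (e.1 - -vA, e.2))
        (Finset.mem_coe.1 he))))
  · -- joint gauge invariance
    intro g U
    rw [map_mul, hAg, hBg, configShift_neg_gaugeTransformZd, configShift_neg_gaugeTransformZd,
      A.gaugeInvariant, B.gaugeInvariant]
  · -- the placement identity
    intro S _ u U
    unfold QCDLatticeObservable.onTorus
    dsimp only
    rw [map_mul, hAp, hBp, neg_add_rev u vA, neg_add_rev u vB, configShift_add', configShift_add']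
  · -- additive flavour charge
    intro qA qB hA hB t ht U
    change QCDLatticeObservable.flavourScale t
        (ΦA (A.F (configShift (-vA) U)) * ΦB (B.F (configShift (-vB) U))) =
      (∏ f, t f ^ ((qA + qB) f)) • (ΦA (A.F (configShift (-vA) U)) * ΦB (B.F (configShift (-vB) U)))
    rw [map_mul, hAt, hBt, hA t ht, hB t ht, map_smul, map_smul, smul_mul_smul_comm,
      prod_zpow_mul_prod_zpow ht]

/-! ### The registered stub -/

/-- **Stub `stub_composite_observable` of the birth skeleton of `TorusHalfSpectrum` (= `CompositeStmt`)**: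
the split composite `A · τ_v B` of two gauge-invariant local lattice-QCD observables exists as ONE
gauge-invariant local observable `N` (quark box `R'' = R + R' + Σ_i |v_i|`), with the placement identity
`N.onTorus (2S+1) u U = A.onTorus (2S+1) u U * B.onTorus (2S+1) (u+v) U` on every odd torus and additive
flavour charge (`exists_composite` with `v_A = 0`, `v_B = v`). -/
theorem stub_composite_observable :
    ∀ (Nf R R' : ℕ) (A : QCDLatticeObservable Nf R) (B : QCDLatticeObservable Nf R')
      (v : _root_.Literature.Probability.LatticeModels.Site 4),
      ∃ (R'' : ℕ) (N : QCDLatticeObservable Nf R''),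
        (∀ (S : ℕ) (u : _root_.Literature.Probability.LatticeModels.Site 4)
            (U : GaugeConfig 4 (2 * S + 1) (Matrix.specialUnitaryGroup (Fin 3) ℂ)),
            N.onTorus (2 * S + 1) u U = A.onTorus (2 * S + 1) u U * B.onTorus (2 * S + 1) (u + v) U) ∧
        ∀ qA qB : Fin Nf → ℤ,
          (∀ t : Fin Nf → ℂ, (∀ f, t f ≠ 0) → ∀ U,
              QCDLatticeObservable.flavourScale t (A.F U) = (∏ f, t f ^ (qA f)) • A.F U) →
          (∀ t : Fin Nf → ℂ, (∀ f, t f ≠ 0) → ∀ U,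
              QCDLatticeObservable.flavourScale t (B.F U) = (∏ f, t f ^ (qB f)) • B.F U) →
          ∀ t : Fin Nf → ℂ, (∀ f, t f ≠ 0) → ∀ U,
              QCDLatticeObservable.flavourScale t (N.F U) = (∏ f, t f ^ ((qA + qB) f)) • N.F U := by
  intro Nf R R' A B v
  obtain ⟨σA, hσA⟩ := exists_boxShift (R := R) (R'' := R + R' + ∑ i, (v i).natAbs) 0 fun i => by
    simp only [Pi.zero_apply, Int.natAbs_zero, add_zero]
    omega
  obtain ⟨σB, hσB⟩ := exists_boxShift (R := R') (R'' := R + R' + ∑ i, (v i).natAbs) v fun i => by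
    have h := Finset.single_le_sum (fun j _ => Nat.zero_le ((v j).natAbs)) (Finset.mem_univ i)
    omega
  obtain ⟨N, hN, hq⟩ := exists_composite A B 0 v σA hσA σB hσB
  refine ⟨R + R' + ∑ i, (v i).natAbs, N, fun S u U => ?_, hq⟩
  rw [hN, add_zero]

end Summit.QuantumFields.QCD.Cruxes.TorusHalfSpectrum.Birth.CompositeObservable

end
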